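import Summits.Ventures.PercRepro.Night2T3C9Q4M0P1
import Summits.Ventures.PercRepro.Night2T3C9Q4M0P2
import Summits.Ventures.PercRepro.Night2T3C9Q4M0P3
import Summits.Ventures.PercRepro.Night2T3C9Q4M0P4

/-!
# PercRepro — corank `9`, `q = 4`, `m(G) = 0`: the certificate (night-2 gen 3, NIGHT-2-profile.md §3d)
The facts of the cyclic-rank profile (P1)–(P3), the line facts (L1)–(L5) and the weighted rises (L4), instantiated in `ℚ`,
and the exact dual certificate of the profile LP (`leanlp_c7.py`) checked by `linear_combination`.
-/
namespace PercRepro.Star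

open Finset ThmH SixFour GenQ

variable {α : Type*} [DecidableEq α] {M : Matroid α} [M.Finite]

/-- Corank `9`, `q = 4`, `m(G) = 0` (coloop-free rank `4`): the exact dual certificate. -/
theorem Jq_three_nonneg_c9_q4_m0 (hs : Simple M) {G : Finset α} (hG : G ⊆ gr M) (hrG : M.eRk (G : Set α) = ((4 : ℕ) : ℕ∞)) (hcard : G.card = 4 + 9) (hmG : mTr M G = 0) : 0 ≤ Jq M G 4 3 := by
  have hpos : (0 : ℚ) < ((4 : ℕ) : ℚ) + 1 := by norm_num
  suffices hmain : 0 ≤ (((4 : ℕ) : ℚ) + 1) * Jq M G 4 3 from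
    le_of_mul_le_mul_left (by rw [mul_zero]; exact hmain) hpos
  have e_0_4 : Finset.Icc (0 : ℕ) 4 = {0, 1, 2, 3, 4} := by
    ext x; simp only [Finset.mem_Icc, Finset.mem_insert, Finset.mem_singleton]; omega
  have hsum : ∀ f : ℕ → ℚ, ∑ m ∈ Finset.Icc (0 : ℕ) 4, f m = f 0 + f 1 + f 2 + f 3 + f 4 := by
    intro f
    rw [e_0_4, Finset.sum_insert (by simp), Finset.sum_insert (by simp), Finset.sum_insert (by simp), Finset.sum_insert (by simp), Finset.sum_singleton]
    ring
  rw [Jq_three_mul_succ_eq_profile hG hrG hcard, hmG]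
  simp only [hsum, Finset.sum_range_succ, Finset.sum_range_zero]
  push_cast
  norm_num
  have t0 := c9_q4_m0_cert_0 hs hG hrG hcard hmG
  have t1 := c9_q4_m0_cert_1 hs hG hrG hcard hmG
  have t2 := c9_q4_m0_cert_2 hs hG hrG hcard hmG
  have t3 := c9_q4_m0_cert_3 hs hG hrG hcard hmG
  have t4 := c9_q4_m0_cert_4 hs hG hrG hcard hmG
  have t5 := c9_q4_m0_cert_5 hs hG hrG hcard hmG
  have t6 := c9_q4_m0_cert_6 hs hG hrG hcard hmG
  have t7 := c9_q4_m0_cert_7 hs hG hrG hcard hmG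
  have t8 := c9_q4_m0_cert_8 hs hG hrG hcard hmG
  have ttop := c9_q4_m0_cert_top hs hG hrG hcard hmG
  linear_combination t0 + t1 + t2 + t3 + t4 + t5 + t6 + t7 + t8 + ttop

end PercRepro.Star
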